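import Mathlib
import Summits.Ventures.HodgeRepro2.A2TripleSumPairingDegree
import Summits.Ventures.HodgeRepro2.A2ModelDuality

/-!
# A2 annex — Corollary A8.2 in its final model form: `p_W(m₃_*(f_*c₁ ⊗ f_*c₂ ⊗ θ⁴)) = 0`

With the triple pairing of `A2TripleSumPairing` (`pairThree Φ₁ Φ₂ Ψ = (Φ₁ ⊗ Φ₂ ⊗ Ψ) ∘ m₃^*`, the
functional `u ↦ ⟨y', u⟩` of Corollary A8.2, route/T4-A2-p6.md v6 ll. 115–118) and Poincaré duality
of `A2ModelDuality` (`dualOf`), the class `y' = m₃_*(f_*c₁ ⊗ f_*c₂ ⊗ θ⁴)` of the corollary becomes a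
DEFINITION in the model — `gysinTriple Φ₁ Φ₂ Ψ := dualOf (pairThree Φ₁ Φ₂ Ψ)`, the Poincaré dual of
the functional, exactly as A4.1.0 defines Gysin maps (`g_* = PD^{-1} ∘ g_*^{hom} ∘ PD`) — and the
corollary reads: **every Weil coordinate `∫_B y' ∧ E_{I_σ} ∧ w_σ` of `y'` vanishes**
(`weilCoordinate_gysinTriple_eq_zero`), which is `p_W(y') = 0` in the coordinate form of Lemma A5.6
(p5's `integral_sum_mul_ET_mul_weil`).  Hypotheses: `Φ₂ = ∫_B z₂ ∧ (·)` with `z₂ ∈ ⋀^{2|ι| − 2}`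
(`deg f_*c₂ = 22`) and `∫_B z₂ ∧ e_{a,σ} ∧ e_{b,σ} = 0` for `a ≠ b` in `P₀` (Proposition A8.1 for
`c₂`), all `c_p ≠ 0` (A4.2.7); `z₁` and `c` arbitrary.  The mirror statement with the hypotheses on
`z₁` is `weilCoordinate_gysinTriple_eq_zero_left`.

What stays prose: the identification of `pairThree` with `∫_{B³} (f_*c₁ ⊗ f_*c₂ ⊗ θ⁴) ∪ m₃^*(·)`
(Künneth / projection formula), `deg f_*c_j = 22`, Proposition A8.1, and Lemma A5.6 beyond its
coordinate form.  Seat p6 (A2 owner), gen 16.  §8 (d): uses an L-value-free non-vanishing device: NO.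
-/

namespace Summit.Ventures.HodgeRepro2.A2TripleSumGysin

open WeilPlanes WeilIntegral WeilDetect A2TripleSumPairing A2TripleSumPairingDegree A2ModelDuality
  A2IntegralDegree

variable {ι : Type*} [DecidableEq ι] [Fintype ι]

/-- The model of the Gysin push-forward `m₃_*(z₁ ⊗ z₂ ⊗ v)`: the Poincaré dual of the triple pairing
`u ↦ ∫_{B³} (z₁ ⊗ z₂ ⊗ v) ∪ m₃^* u` (for `Φⱼ = ∫_B zⱼ ∧ (·)`, `Ψ = ∫_B v ∧ (·)`). -/
noncomputable def gysinTriple (Φ₁ Φ₂ Ψ : A ι →ₗ[ℂ] ℂ) : A ι := dualOf (pairThree Φ₁ Φ₂ Ψ)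

/-- `gysinTriple` represents the triple pairing: `∫_B m₃_*(z₁ ⊗ z₂ ⊗ v) ∧ u = ⟨m₃_*(…), u⟩`
(Lemma A4.1.1 (ii) for `m₃`, in the model). -/
theorem integral_gysinTriple_mul (Φ₁ Φ₂ Ψ : A ι →ₗ[ℂ] ℂ) (u : A ι) :
    integral (gysinTriple Φ₁ Φ₂ Ψ * u) = pairThree Φ₁ Φ₂ Ψ u :=
  integral_dualOf_mul _ u

/-- **Corollary A8.2 (final model form).**  The Weil coordinates of
`y' = m₃_*(f_*c₁ ⊗ f_*c₂ ⊗ θ^{|P₀|})` vanish: `∫_B y' ∧ E_{I_σ} ∧ w_σ = 0` for every Weil datum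
`(P₀, s)`, whenever `z₂ ∈ ⋀^{2|ι| − 2}` pairs to zero with every `e_{a,σ} ∧ e_{b,σ}` (`a ≠ b`) and
all `c_p ≠ 0`. -/
theorem weilCoordinate_gysinTriple_eq_zero (hι : 1 ≤ Fintype.card ι) (P₀ : Finset ι) (s : Bool)
    (c : ι → ℂ) (hc : ∀ p, c p ≠ 0) (z₁ : A ι) {z₂ : A ι}
    (hz₂ : z₂ ∈ (⋀[ℂ]^(2 * Fintype.card ι - 2) (V ι) : Submodule ℂ (A ι)))
    (hA81 : ∀ a ∈ P₀, ∀ b ∈ P₀, a ≠ b → integral (z₂ * (gen (a, s) * gen (b, s))) = 0) :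
    integral (gysinTriple (integral ∘ₗ LinearMap.mulLeft ℂ z₁) (integral ∘ₗ LinearMap.mulLeft ℂ z₂)
      (psi c P₀.card) * (ET (Finset.univ \ P₀) * weil P₀ s)) = 0 :=
  integral_mul_ET_mul_weil_eq_zero_of_represents P₀ s c hc _ _
    (fun l hl => integral_mul_mono_eq_zero_of_degree_two_complement hι hz₂ l hl)
    (fun a ha b hb hab => hA81 a ha b hb hab) _
    (integral_gysinTriple_mul _ _ _)

/-- `⟨y', θ^{|I_σ|} ∧ w_σ⟩ = 0` itself, for the represented class (the form in which the printed
proof states the vanishing before the detection lemma). -/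
theorem integral_gysinTriple_mul_theta_pow_mul_weil (P₀ : Finset ι) (s : Bool) (c : ι → ℂ)
    (Φ₁ Φ₂ : A ι →ₗ[ℂ] ℂ)
    (hdeg : ∀ l : List (Gen ι), l.length ≠ 2 → Φ₂ (mono l) = 0)
    (hA81 : ∀ a ∈ P₀, ∀ b ∈ P₀, a ≠ b → Φ₂ (gen (a, s) * gen (b, s)) = 0) :
    integral (gysinTriple Φ₁ Φ₂ (psi c P₀.card) *
      (theta c ^ (Finset.univ \ P₀).card * weil P₀ s)) = 0 := by
  rw [integral_gysinTriple_mul]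
  exact pairThree_theta_pow_mul_weil_eq_zero P₀ s c Φ₁ Φ₂ hdeg hA81

/-- The mirror image with the hypotheses on the first curve class `z₁`. -/
theorem weilCoordinate_gysinTriple_eq_zero_left (hι : 1 ≤ Fintype.card ι) (P₀ : Finset ι)
    (s : Bool) (c : ι → ℂ) (hc : ∀ p, c p ≠ 0) {z₁ : A ι} (z₂ : A ι)
    (hz₁ : z₁ ∈ (⋀[ℂ]^(2 * Fintype.card ι - 2) (V ι) : Submodule ℂ (A ι)))
    (hA81 : ∀ a ∈ P₀, ∀ b ∈ P₀, a ≠ b → integral (z₁ * (gen (a, s) * gen (b, s))) = 0) :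
    integral (gysinTriple (integral ∘ₗ LinearMap.mulLeft ℂ z₁) (integral ∘ₗ LinearMap.mulLeft ℂ z₂)
      (psi c P₀.card) * (ET (Finset.univ \ P₀) * weil P₀ s)) = 0 := by
  have hE : ∀ p ∈ P₀, E p * weil P₀ s = 0 := fun p hp =>
    E_mul_mono_of_mem (mem_weilList.mpr ⟨hp, rfl⟩)
  have h := pairThree_integral_eq_zero_of_mem_grading_left hι P₀ s c z₂ hz₁ hA81
  rw [← integral_gysinTriple_mul, theta_pow_card_mul c P₀ _ hE, mul_smul_comm, map_smul,
    smul_eq_zero] at h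
  refine h.resolve_left ?_
  refine mul_ne_zero (Nat.cast_ne_zero.mpr (Nat.factorial_ne_zero _)) ?_
  exact Finset.prod_ne_zero_iff.mpr fun p _ => hc p

end Summit.Ventures.HodgeRepro2.A2TripleSumGysin
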